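import Summits.ResolutionOfSingularities.KangarooAtlas.MizutaniBoxWeight
import HarnessLib

/-!
# The truncated polynomial ring `K[u, σ]/(u^p, σ^p)`: the substitutions `u ↦ u + bσ + cσ²` and the chain rule

Cell topic `Summits/ResolutionOfSingularities/KangarooAtlas` (pub-rosobs); namespace
`Summit.ResolutionOfSingularities.KangarooAtlas.Mizutani`.  Part of the Lean transcription of Mizutani 1973 §2
around the in-house note MIZUTANI-PROOF-g59 (AI-written, AI-audited; *AI review is weaker than expert review*; not a
resolution theorem).  In characteristic `p` the substitution `X₀ ↦ X₀ + b X₁ + c X₁²`, `X₁ ↦ X₁` preserves the ideal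
`(X₀^p, X₁^p)` (Frobenius is additive), so it induces a `K`-algebra automorphism of `K[X₀, X₁]/(X₀^p, X₁^p)`; the
partial derivatives transform by the chain rule.  Used to straighten the leading part of the base-changed operator
in the equality case of Mizutani's Lemma 2.9:

* `substHom b c`, `substHom_comp`, `substHom_zero`; `map_boxIdeal_le`; `substQ b c` on the quotient, `substQ_mk`,
  `substQ_substQ`, `substEquiv` (an `AlgEquiv`);
* CHAIN RULE: `pderiv_zero_substHom` (`∂₀ ∘ θ = θ ∘ ∂₀`), `pderiv_one_substHom`
  (`∂₁ (θ f) = θ(∂₁ f) + (b + 2c X₁)·θ(∂₀ f)`), and on the quotient `boxDeriv_zero_substQ`, `boxDeriv_one_substQ`;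
* weights: `substQ_mk_X_mem_wdegIdeal`, `substQ_mem_wdegIdeal` — `θ̄` maps classes of ordinary order `≥ m` to classes of
  `ω`-weight `≥ m` whenever both `θ̄(X_i)` have `ω`-weight `≥ 1`.

References: [Mizutani1973HironakaGroupSchemes] Lemma 2.9 (2) (proof outline, p. 94); folklore.
-/

open MvPolynomial Literature.AlgebraicGeometry.Resolution

namespace Summit.ResolutionOfSingularities.KangarooAtlas.Mizutani

section Subst

variable {K : Type*} [Field K] {p : ℕ} [hp : Fact p.Prime] [CharP K p]

variable (K) in
/-- **The substitution `θ_{b,c} : X₀ ↦ X₀ + b X₁ + c X₁²`, `X₁ ↦ X₁`** on `K[X₀, X₁]`. [folklore] -/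
noncomputable def substHom (b c : K) : MvPolynomial (Fin 2) K →ₐ[K] MvPolynomial (Fin 2) K :=
  aeval ![X 0 + C b * X 1 + C c * X 1 ^ 2, X 1]

omit hp [CharP K p] in
/-- `θ (X₀) = X₀ + b X₁ + c X₁²`. [folklore] -/
@[simp] theorem substHom_X_zero (b c : K) : substHom K b c (X 0) = X 0 + C b * X 1 + C c * X 1 ^ 2 := by
  unfold substHom; rw [aeval_X]; rfl

omit hp [CharP K p] in
/-- `θ (X₁) = X₁`. [folklore] -/
@[simp] theorem substHom_X_one (b c : K) : substHom K b c (X 1) = X 1 := by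
  unfold substHom; rw [aeval_X]; rfl

omit hp [CharP K p] in
/-- `θ (C a) = C a`. [folklore] -/
@[simp] theorem substHom_C (b c a : K) : substHom K b c (C a) = C a := by
  unfold substHom; rw [aeval_C]; rfl

omit hp [CharP K p] in
/-- **Composition**: `θ_{b,c} ∘ θ_{b',c'} = θ_{b+b', c+c'}`. [folklore] -/
theorem substHom_comp (b c b' c' : K) : (substHom K b c).comp (substHom K b' c') = substHom K (b + b') (c + c') := by
  refine MvPolynomial.algHom_ext fun i => ?_
  fin_cases i
  · show substHom K b c (substHom K b' c' (X 0)) = substHom K (b + b') (c + c') (X 0)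
    rw [substHom_X_zero, substHom_X_zero, map_add, map_add, map_mul, map_mul, map_pow, substHom_X_zero, substHom_X_one,
      substHom_C, substHom_C, C_add, C_add]
    ring
  · show substHom K b c (substHom K b' c' (X 1)) = substHom K (b + b') (c + c') (X 1)
    rw [substHom_X_one, substHom_X_one, substHom_X_one]

omit hp [CharP K p] in
/-- `θ_{0,0} = id`. [folklore] -/
theorem substHom_zero : substHom K (0 : K) 0 = AlgHom.id K _ := by
  refine MvPolynomial.algHom_ext fun i => ?_
  fin_cases i
  · show substHom K 0 0 (X 0) = X 0
    rw [substHom_X_zero, C_0, zero_mul, zero_mul, add_zero, add_zero]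
  · exact substHom_X_one 0 0

/-- **`θ` preserves `(X₀^p, X₁^p)`** (Frobenius is additive). [folklore] -/
theorem map_boxIdeal_le (b c : K) :
    (boxIdeal (Fin 2) K (p ^ 1)).map (substHom K b c) ≤ boxIdeal (Fin 2) K (p ^ 1) := by
  unfold boxIdeal
  rw [Ideal.map_span, Ideal.span_le]
  rintro _ ⟨_, ⟨_, ⟨i, rfl⟩, rfl⟩, rfl⟩
  dsimp only
  rw [← X_pow_eq_monomial, map_pow]
  have hX : ∀ j : Fin 2, (X j : MvPolynomial (Fin 2) K) ^ p ^ 1 ∈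
      Ideal.span ((fun s => monomial s (1 : K)) '' Set.range fun i : Fin 2 => Finsupp.single i (p ^ 1)) :=
    fun j => X_pow_mem_boxIdeal (Fin 2) K (p ^ 1) j
  fin_cases i
  · show substHom K b c (X 0) ^ p ^ 1 ∈ _
    rw [substHom_X_zero, add_pow_char_pow, add_pow_char_pow, mul_pow, mul_pow, ← pow_mul, mul_comm 2, pow_mul]
    refine Ideal.add_mem _ (Ideal.add_mem _ (hX 0) (Ideal.mul_mem_left _ _ (hX 1))) (Ideal.mul_mem_left _ _ ?_)
    exact Ideal.pow_mem_of_mem _ (hX 1) _ two_pos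
  · show substHom K b c (X 1) ^ p ^ 1 ∈ _
    rw [substHom_X_one]
    exact hX 1

/-- `(X₀^p, X₁^p) ≤ θ⁻¹ (X₀^p, X₁^p)`. [folklore] -/
theorem boxIdeal_le_comap (b c : K) :
    boxIdeal (Fin 2) K (p ^ 1) ≤ (boxIdeal (Fin 2) K (p ^ 1)).comap (substHom K b c) :=
  Ideal.map_le_iff_le_comap.mp (map_boxIdeal_le b c)

variable (K) in
/-- **The substitution on the truncated ring** `θ̄_{b,c} : K[X]/(X^p) → K[X]/(X^p)`. [folklore] -/
noncomputable def substQ (b c : K) : BoxQuot (Fin 2) K (p ^ 1) →ₐ[K] BoxQuot (Fin 2) K (p ^ 1) :=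
  Ideal.quotientMapₐ _ (substHom K b c) (boxIdeal_le_comap b c)

/-- `θ̄ [f] = [θ f]`. [folklore] -/
theorem substQ_mk (b c : K) (f : MvPolynomial (Fin 2) K) :
    substQ K b c (Ideal.Quotient.mk _ f) = Ideal.Quotient.mk _ (substHom K b c f) := by
  unfold substQ; rw [Ideal.quotient_map_mkₐ]; rfl

/-- `θ̄_{b,c} (θ̄_{b',c'} z) = θ̄_{b+b',c+c'} z`. [folklore] -/
theorem substQ_substQ (b c b' c' : K) (z : BoxQuot (Fin 2) K (p ^ 1)) :
    substQ K b c (substQ K b' c' z) = substQ K (b + b') (c + c') z := by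
  obtain ⟨f, rfl⟩ := Ideal.Quotient.mk_surjective z
  rw [substQ_mk, substQ_mk, substQ_mk, ← AlgHom.comp_apply, substHom_comp]

/-- `θ̄_{0,0} = id`. [folklore] -/
theorem substQ_zero (z : BoxQuot (Fin 2) K (p ^ 1)) : substQ K (0 : K) 0 z = z := by
  obtain ⟨f, rfl⟩ := Ideal.Quotient.mk_surjective z
  rw [substQ_mk, substHom_zero, AlgHom.id_apply]

variable (K) in
/-- **`θ̄_{b,c}` is an automorphism**, with inverse `θ̄_{−b,−c}`. [folklore] -/
noncomputable def substEquiv (b c : K) : BoxQuot (Fin 2) K (p ^ 1) ≃ₐ[K] BoxQuot (Fin 2) K (p ^ 1) :=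
  AlgEquiv.ofAlgHom (substQ K b c) (substQ K (-b) (-c))
    (by ext z; rw [AlgHom.comp_apply, substQ_substQ, add_neg_cancel, add_neg_cancel, substQ_zero]; rfl)
    (by ext z; rw [AlgHom.comp_apply, substQ_substQ, neg_add_cancel, neg_add_cancel, substQ_zero]; rfl)

/-- `substEquiv` is `substQ`. [folklore] -/
theorem substEquiv_apply (b c : K) (z : BoxQuot (Fin 2) K (p ^ 1)) : substEquiv K b c z = substQ K b c z := rfl

/-- The inverse of `substEquiv`. [folklore] -/
theorem substEquiv_symm_apply (b c : K) (z : BoxQuot (Fin 2) K (p ^ 1)) :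
    (substEquiv K b c).symm z = substQ K (-b) (-c) z := rfl

/-! ### The chain rule -/

omit hp [CharP K p] in
/-- `∂₀` of the images of the variables. [folklore] -/
theorem pderiv_zero_substHom_X (b c : K) (i : Fin 2) :
    pderiv 0 (substHom K b c (X i)) = substHom K b c (pderiv 0 (X i)) := by
  fin_cases i
  · show pderiv 0 (substHom K b c (X 0)) = substHom K b c (pderiv 0 (X 0))
    rw [substHom_X_zero, pderiv_X_self, map_one, map_add, map_add, pderiv_X_self, pderiv_C_mul, pderiv_C_mul,
      pderiv_X_of_ne (by decide : (1 : Fin 2) ≠ 0), pderiv_pow, pderiv_X_of_ne (by decide : (1 : Fin 2) ≠ 0)]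
    simp
  · show pderiv 0 (substHom K b c (X 1)) = substHom K b c (pderiv 0 (X 1))
    rw [substHom_X_one, pderiv_X_of_ne (by decide : (1 : Fin 2) ≠ 0), map_zero]

omit hp [CharP K p] in
/-- `∂₁` of the images of the variables. [folklore] -/
theorem pderiv_one_substHom_X (b c : K) (i : Fin 2) :
    pderiv 1 (substHom K b c (X i)) = substHom K b c (pderiv 1 (X i)) + (C b + C (2 * c) * X 1) * substHom K b c (pderiv 0 (X i)) := by
  fin_cases i
  · show pderiv 1 (substHom K b c (X 0)) = substHom K b c (pderiv 1 (X 0)) + (C b + C (2 * c) * X 1) * substHom K b c (pderiv 0 (X 0))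
    have hL : pderiv 1 (substHom K b c (X 0)) = C b + 2 * C c * X 1 := by
      rw [substHom_X_zero, map_add, map_add, pderiv_X_of_ne (by decide : (0 : Fin 2) ≠ 1), zero_add, pderiv_C_mul,
        pderiv_C_mul, pderiv_X_self, mul_one, pderiv_pow, pderiv_X_self, mul_one]
      simp only [Nat.cast_ofNat, Nat.add_one_sub_one, pow_one]
      ring
    have hR : substHom K b c (pderiv 1 (X 0)) + (C b + C (2 * c) * X 1) * substHom K b c (pderiv 0 (X 0)) =
        C b + 2 * C c * X 1 := by
      rw [pderiv_X_of_ne (by decide : (0 : Fin 2) ≠ 1), map_zero, zero_add, pderiv_X_self, map_one, mul_one, map_mul,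
        map_ofNat]
    rw [hL, hR]
  · show pderiv 1 (substHom K b c (X 1)) = substHom K b c (pderiv 1 (X 1)) + (C b + C (2 * c) * X 1) * substHom K b c (pderiv 0 (X 1))
    rw [substHom_X_one, pderiv_X_self, pderiv_X_of_ne (by decide : (1 : Fin 2) ≠ 0), map_one, map_zero, mul_zero, add_zero]

omit hp [CharP K p] in
/-- **`∂₀ ∘ θ = θ ∘ ∂₀`** (`θ` moves `X₀` by a function of `X₁` only). [folklore] -/
theorem pderiv_zero_substHom (b c : K) (f : MvPolynomial (Fin 2) K) :
    pderiv 0 (substHom K b c f) = substHom K b c (pderiv 0 f) := by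
  induction f using MvPolynomial.induction_on with
  | C a => simp only [substHom_C, pderiv_C, map_zero]
  | add f g hf hg => rw [map_add, map_add, map_add, map_add, hf, hg]
  | mul_X f i hf =>
    rw [map_mul, pderiv_mul, pderiv_mul, hf, map_add, map_mul, map_mul, pderiv_zero_substHom_X]

omit hp [CharP K p] in
/-- **`∂₁ (θ f) = θ (∂₁ f) + (b + 2c X₁) · θ (∂₀ f)`** (chain rule). [folklore] -/
theorem pderiv_one_substHom (b c : K) (f : MvPolynomial (Fin 2) K) :
    pderiv 1 (substHom K b c f) = substHom K b c (pderiv 1 f) + (C b + C (2 * c) * X 1) * substHom K b c (pderiv 0 f) := by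
  induction f using MvPolynomial.induction_on with
  | C a => simp only [substHom_C, pderiv_C, map_zero, mul_zero, add_zero]
  | add f g hf hg => rw [map_add, map_add, map_add, map_add, map_add, map_add, hf, hg]; ring
  | mul_X f i hf =>
    rw [map_mul, pderiv_mul, pderiv_mul, pderiv_mul, hf, pderiv_one_substHom_X]
    simp only [map_add, map_mul]
    ring

/-- **Chain rule on the quotient, `X₀`-direction**: `∂₀ (θ̄ z) = θ̄ (∂₀ z)`. [folklore] -/
theorem boxDeriv_zero_substQ (b c : K) (z : BoxQuot (Fin 2) K (p ^ 1)) :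
    boxDeriv K 2 (p ^ 1) 0 (substQ K b c z) = substQ K b c (boxDeriv K 2 (p ^ 1) 0 z) := by
  obtain ⟨f, rfl⟩ := Ideal.Quotient.mk_surjective z
  rw [substQ_mk, boxDeriv_mk le_rfl, boxDeriv_mk le_rfl, substQ_mk, pderiv_zero_substHom]

/-- **Chain rule on the quotient, `X₁`-direction**: `∂₁ (θ̄ z) = θ̄ (∂₁ z) + [b + 2c X₁] · θ̄ (∂₀ z)`. [folklore] -/
theorem boxDeriv_one_substQ (b c : K) (z : BoxQuot (Fin 2) K (p ^ 1)) :
    boxDeriv K 2 (p ^ 1) 1 (substQ K b c z) =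
      substQ K b c (boxDeriv K 2 (p ^ 1) 1 z) +
        Ideal.Quotient.mk _ (C b + C (2 * c) * X 1) * substQ K b c (boxDeriv K 2 (p ^ 1) 0 z) := by
  obtain ⟨f, rfl⟩ := Ideal.Quotient.mk_surjective z
  rw [substQ_mk, boxDeriv_mk le_rfl, boxDeriv_mk le_rfl, boxDeriv_mk le_rfl, substQ_mk, substQ_mk, pderiv_one_substHom,
    map_add, map_mul]

/-! ### Weights under the substitution -/

/-- `θ̄ [X₀] = [X₀] + b [X₁] + c [X₁]²` lies in `wdegIdeal ω 1` when `ω 0, ω 1 ≥ 1`. [folklore] -/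
theorem substQ_mk_X_mem_wdegIdeal (b c : K) (ω : Fin 2 → ℕ) (hω : ∀ i, 1 ≤ ω i) (i : Fin 2) :
    substQ K b c (Ideal.Quotient.mk _ (X i)) ∈ wdegIdeal K 2 (p ^ 1) ω 1 := by
  rw [substQ_mk]
  have hX : ∀ j : Fin 2, Ideal.Quotient.mk (boxIdeal (Fin 2) K (p ^ 1)) (X j) ∈ wdegIdeal K 2 (p ^ 1) ω 1 := fun j =>
    wdegIdeal_anti ω (hω j) (mk_X_mem_wdegIdeal ω j)
  fin_cases i
  · show Ideal.Quotient.mk _ (substHom K b c (X 0)) ∈ _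
    rw [substHom_X_zero, map_add, map_add, map_mul, map_mul, map_pow]
    refine Ideal.add_mem _ (Ideal.add_mem _ (hX 0) (Ideal.mul_mem_left _ _ (hX 1))) (Ideal.mul_mem_left _ _ ?_)
    exact wdegIdeal_anti ω (by omega) (Ideal.pow_mem_of_mem _ (hX 1) 2 two_pos)
  · show Ideal.Quotient.mk _ (substHom K b c (X 1)) ∈ _
    rw [substHom_X_one]; exact hX 1

/-- **`θ̄` maps classes of order `≥ m` to classes of `ω`-weight `≥ m`** (for `ω 0, ω 1 ≥ 1`): if all monomials of `f`
have degree `≥ m` then `θ̄ [f] ∈ wdegIdeal ω m`. [folklore] -/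
theorem substQ_mk_mem_wdegIdeal (b c : K) (ω : Fin 2 → ℕ) (hω : ∀ i, 1 ≤ ω i) {m : ℕ} {f : MvPolynomial (Fin 2) K}
    (hf : ∀ M ∈ f.support, m ≤ M.degree) : substQ K b c (Ideal.Quotient.mk _ f) ∈ wdegIdeal K 2 (p ^ 1) ω m := by
  classical
  rw [f.as_sum, map_sum, map_sum]
  refine Submodule.sum_mem _ fun M hM => ?_
  rw [monomial_eq, map_mul, map_mul, Finsupp.prod_fintype _ _ (fun i => by simp), map_prod, map_prod]
  refine Ideal.mul_mem_left _ _ (wdegIdeal_anti ω (hf M hM) ?_)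
  -- `∏ θ̄[X_i]^{M_i} ∈ wdegIdeal (Σ M_i) = wdegIdeal |M|`
  have hdeg : M.degree = ∑ i, M i := by
    rw [Finsupp.degree_eq_sum]
  rw [hdeg]
  have key : ∀ (t : Finset (Fin 2)), (∏ i ∈ t, substQ K b c (Ideal.Quotient.mk _ (X i)) ^ M i) ∈
      wdegIdeal K 2 (p ^ 1) ω (∑ i ∈ t, M i) := by
    intro t
    induction t using Finset.induction_on with
    | empty => simp only [Finset.prod_empty, Finset.sum_empty]; exact mem_wdegIdeal_zero ω 1
    | insert j t hj ih =>
      rw [Finset.prod_insert hj, Finset.sum_insert hj]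
      refine mul_mem_wdegIdeal ω ?_ ih
      have hpow : ∀ n : ℕ, substQ K b c (Ideal.Quotient.mk _ (X j)) ^ n ∈ wdegIdeal K 2 (p ^ 1) ω n := by
        intro n
        induction n with
        | zero => rw [pow_zero]; exact mem_wdegIdeal_zero ω 1
        | succ n ihn =>
          rw [pow_succ (substQ K b c (Ideal.Quotient.mk _ (X j))) n]
          exact mul_mem_wdegIdeal ω ihn (substQ_mk_X_mem_wdegIdeal b c ω hω j)
      exact hpow (M j)
  have := key Finset.univ
  simpa only [map_pow] using this

end Subst

end Summit.ResolutionOfSingularities.KangarooAtlas.Mizutani
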